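import Summits.NavierStokesRegularity.FluidComputer.PalasekTowerRegisterGlobalMargin
import Summits.NavierStokesRegularity.FluidComputer.PalasekTowerRegisterGlobalViscosity
import Summits.NavierStokesRegularity.FluidComputer.PalasekTowerClayBridgePathB

/-!
# REGISTER v2.3′: the W14-FREE closers (PATH B′) for the items of record, the margin-parametric pair,
# the designed pair and the viscosity-parametric pair

Cell `ns-blowup`, seat `ns-blowup-ecbridge-1` (g4); companion of `PalasekTowerClayBridgePathB.lean`
(ns-blowup-lean: `navierStokesBreakdownR3_of_step2_B : PalasekStep2 R → NavierStokesBreakdownR3` with NO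
named-fact hypothesis — forced Serrin–Masuda weak–strong uniqueness `NSSerrinUniquenessForced` and the
forced pressure normalisation a.e. `TaoForcedNormalisedPressureDischarge` are tree THEOREMS),
`PalasekTowerRegisterGlobalMargin.lean` (p420640), `PalasekTowerRegisterGlobalViscosity.lean` (p420110)
and `PalasekTowerRegisterGlobal.lean` (p411629). LABEL: E–C typing (closers; every implication proved).
WHAT THIS IS NOT: not Navier–Stokes evidence — CONDITIONAL theorems whose hypotheses are the open
`@[conjecture]` pairs; nothing is asserted; no item is changed (planner ACK STATUS l.2117 (2): «the
designed carrier should not re-introduce W14 once PATH B′ retires it from `closes`»).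

References: S. Palasek, arXiv:2605.13827 §4 [cite: Palasek2026ElementaryModel, §4]; C. L. Fefferman,
Clay problem description, (C) [cite: FeffermanClay2006, (C)]; H. Sohr, The Navier–Stokes equations
(2001), Thm. V.1.5.1 [cite: Sohr2001, Thm. V.1.5.1].
-/

noncomputable section

namespace Summit.NavierStokesRegularity.FluidComputer.PalasekTowerClayBridge

open Set MeasureTheory Filter Topology Function
open scoped ENNReal ContDiff NNReal
open Literature.Analysis.FluidPDE

/-- **The items of record give (C) with NO named fact** (PATH B′): K1G → K2G → Fefferman's (C).
Conditional on the two open items; nothing asserted. [cite: FeffermanClay2006, (C)] -/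
theorem navierStokesBreakdownR3_of_episodesG_B (h₁ : EpisodeBaseG) (h₂ : EpisodeInductionG) :
    Summit.NavierStokesRegularity.NavierStokesRegularity.NavierStokesBreakdownR3 :=
  navierStokesBreakdownR3_of_step2_B TowerRates.wide (palasekStep2_of_episodesG h₁ h₂)

/-- **The margin-parametric pair gives (C) with NO named fact**: K1G(m) → K2G(m) → (C), for every margin
`m`. Conditional; nothing asserted. [cite: FeffermanClay2006, (C)] -/
theorem navierStokesBreakdownR3_of_episodesGM_B {m : Margins TowerRates.wide} (h₁ : EpisodeBaseGM m)
    (h₂ : EpisodeInductionGM m) :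
    Summit.NavierStokesRegularity.NavierStokesRegularity.NavierStokesBreakdownR3 :=
  navierStokesBreakdownR3_of_step2_B TowerRates.wide (palasekStep2_of_episodesGM h₁ h₂)

/-- **A designed pair gives (C) with NO named fact** — the honest `∃ D, ∀ stage in D` route's closer
after PATH B′: base in the design + heredity in the design ⇒ (C), for any design `D` over any margin
`m`. Conditional; nothing asserted. [cite: FeffermanClay2006, (C)] -/
theorem navierStokesBreakdownR3_of_designed_B {D m : Margins TowerRates.wide}
    (h₁ : EpisodeBaseGM (Margins.withDesign D m)) (h₂ : EpisodeInductionGM (Margins.withDesign D m)) :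
    Summit.NavierStokesRegularity.NavierStokesRegularity.NavierStokesBreakdownR3 :=
  navierStokesBreakdownR3_of_episodesGM_B h₁ h₂

/-- **The viscosity-parametric pair gives (C) with NO named fact**: K1G(ν₀) → K2G(ν₀) → (C), for every
`ν₀ > 0` (the pre-announced pivot «same register at a registered ν₀ < 1», planner RULING l.2052 (2)).
Conditional; nothing asserted. [cite: FeffermanClay2006, (C)] -/
theorem navierStokesBreakdownR3_of_episodesGν_B {ν₀ : ℝ} (hν : 0 < ν₀) (h₁ : EpisodeBaseGν ν₀)
    (h₂ : EpisodeInductionGν ν₀) :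
    Summit.NavierStokesRegularity.NavierStokesRegularity.NavierStokesBreakdownR3 :=
  navierStokesBreakdownR3_of_step2_B TowerRates.wide (palasekStep2_of_episodesGν hν h₁ h₂)

end Summit.NavierStokesRegularity.FluidComputer.PalasekTowerClayBridge

end
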